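import Mathlib
import Summits.NavierStokesRegularity.NavierStokesRegularity.Theorems.TypeIQuarterGateScarEnvelopeTypeISatelliteTowerDssCell
import Literature.Barriers.NavierStokesRegularity.NearOneDssTypeIExclusion
import Literature.Analysis.FluidPDE.TypeIAncientMildClassical
import Literature.Analysis.FluidPDE.PineauVicolRSSChaeWolf
import Literature.Analysis.FluidPDE.NSLerayStrongLocalExistence

/-!
# Satellite tower for crux `ScarEnvelopeTypeI` (stmt-NavierStokesRegularity-23843) — Part Z6–Z8: the tame DSS cell meets print (Chae–Wolf 2017 Thm 1.3 = Pineau–Vicol 2026 Thm 1.6, BY NAME); the doubly-minimal DSS/recurrent form; 23843 from the three cell exclusions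

Part Z7, Z6, Z8 of nsreg-p3 g28's ROUND-44 artefact: Z7 ★★ `chaeWolf_threshold_le_pastDss_factor` (an enveloped past-DSS rooted object has factor
`≥ λ₁(A)`, BY NAME from the tree theorem `Literature.Barriers.NavierStokesRegularity.NearOneDssTypeIExclusion_holds`); Z6 ★★ `dss_or_recurrent_doublyMin_of_not_scarEnvelopeTypeI`
(¬23843 ⇒ a DOUBLY-MINIMAL rooted object: past-DSS `λ₀^ℤ` [tame-leaf-enveloped ∨ wild-necklace] ∨ past-DSS-free in a uniformly recurrent DSS-free hull);
Z8 ★★ `scarEnvelopeTypeI_of_cellExclusions` (23843 ⟸ (τ) no tame DSS leaf ∧ (κ) no DSS necklace ∧ (θ) W44-θ — the R44 normal form; conditional, credits nothing).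

PROVENANCE: declaration texts VERBATIM from the HOME artefact of the instrument seat nsreg-p3 g27 (cell `pub/ns-regularity-ideate`):
`round-44/Junction44.lean` (sha16 `ec5c26d3f01f4277`, parts `partZ1…partZ7.lean`; a module written against the TREE, importing route
RecurrentProfiles' crux-1589 dynamics modules BY NAME; memo `round-44/ROUND-44.md` c316de8a95807228), scored PASS ★★ by referee ref3 g27
(`SCORE-p3-ROUND-44-0828.md` f10387a6f12e4133); the author cannot write under `Theorems/`
(`perm.theorems-prover-only`); landed by the prover ns-es-p1 g5 as landing hand of record (director-ns DIRECTOR-NS #237 (3)), split into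
≤ 400-line modules, `E3` spelled out, the artefact's `#guard_msgs … #print axioms` certificates not landed.
`--supports stmt-NavierStokesRegularity-23843 --as helper`.

HONEST FRAMING: instrument theorems about HYPOTHETICAL Type-I zoom limits (Albritton–Barker objects of the census of crux
`TypeIQuarterGate.ScarEnvelopeTypeI`, item 23843); the analytic input is the tree's closure engine (compactness
`local_typeI_compactness_twin_inBall`, sharpened to constant 1 in Part S1; Q1 whole-space), P1 rate inheritance, L8 persistence and the
tree's PROVED small-constant Liouville theorem; Parts R/S are order theory on the re-classing and closure lemmas.  NOTHING OPEN IS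
PROVED: 23843, (L′) `TypeILiouvilleAB` / (L′₀), the GLOBAL (S∞) = `CritAttained`, (M𝐈₁), (E1⁺), (E2ᵣ), route ExtremalTypeIConstant's
cruxes, N0 and Navier–Stokes regularity are OPEN; `critRate`, `levelCrit I`, `liouvilleRate` are `sInf`s that are `0` by junk value
when the defining set is empty (every statement using them carries the nonemptiness hypothesis explicitly).
-/

-- the summit-side namespace repeats a component by design (single-conjunct summit, D-0017)
set_option linter.dupNamespace false

open MeasureTheory Set Metric Filter Topology
open scoped ENNReal NNReal InnerProductSpace
open Literature.Analysis.FluidPDE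

namespace Summit.NavierStokesRegularity.NavierStokesRegularity.Cruxes.ScarEnvelopeTypeI.ZoomDictionary

section HullJunction

variable {U U₁ U₂ W : ℝ → (EuclideanSpace ℝ (Fin 3)) → (EuclideanSpace ℝ (Fin 3))}
  {P : ℝ → (EuclideanSpace ℝ (Fin 3)) → ℝ}
  {H : ℝ → (EuclideanSpace ℝ (Fin 3)) → (EuclideanSpace ℝ (Fin 3)) →L[ℝ] (EuclideanSpace ℝ (Fin 3))}
  {M : ℝ}

/-! #### Z7. THE TAME DSS CELL MEETS PRINT — Chae–Wolf 2017 Thm 1.3 (= Pineau–Vicol 2026 Thm 1.6), BY NAME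
(`Literature.Barriers.NavierStokesRegularity.NearOneDssTypeIExclusion_holds`, a theorem of the tree) -/

/-- The past cut-off of a past-DSS field (`c > 0`) is discretely self-similar in the Literature sense
(`IsDiscretelySelfSimilar c v : nsRescale c v = v`, all `t`). -/
theorem isDiscretelySelfSimilar_pastCut {c : ℝ} (hc : 0 < c) (h : ∀ t < 0, ∀ x, nsRescale c U t x = U t x) :
    IsDiscretelySelfSimilar c (fun t x => if t < 0 then U t x else 0) := by
  unfold IsDiscretelySelfSimilar
  funext t x
  rw [nsRescale_apply]
  by_cases ht : t < 0
  · have key := h t ht x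
    rw [nsRescale_apply] at key
    have ht' : c ^ 2 * t < 0 := mul_neg_of_pos_of_neg (by positivity) ht
    simp only [if_pos ht, if_pos ht', key]
  · have ht' : ¬ c ^ 2 * t < 0 := not_lt.2 (mul_nonneg (sq_nonneg c) (not_lt.1 ht))
    simp only [if_neg ht, if_neg ht', smul_zero]

/-- A Type-I ancient mild field, cut off at `t ≥ 0`, is a classical Navier–Stokes solution on the whole past for ONE
smooth pressure (windows `(-(k+1), 0)` by Fabes–Jones–Rivière `IsTypeIAncientMild.exists_isClassicalNSSolutionOn_Ioo`,
patched by `IsClassicalNSSolutionOn.exists_pressure_Iio_of_Ioo`; the cut-off is invisible on `Iio 0`). -/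
theorem exists_isClassicalNSSolutionOn_pastCut {C : ℝ} (hU : IsTypeIAncientMild C U) :
    ∃ P' : ℝ → (EuclideanSpace ℝ (Fin 3)) → ℝ,
      IsClassicalNSSolutionOn (Iio 0) 1 0 (fun t x => if t < 0 then U t x else 0) P' := by
  have hwin : ∀ k : ℕ, ∃ q : ℝ → (EuclideanSpace ℝ (Fin 3)) → ℝ,
      IsClassicalNSSolutionOn (Ioo (-((k : ℝ) + 1)) 0) 1 0 U q := fun k =>
    hU.exists_isClassicalNSSolutionOn_Ioo (t₀ := -((k : ℝ) + 1)) (by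
      have : (0 : ℝ) ≤ k := Nat.cast_nonneg k
      linarith)
  choose q hq using hwin
  obtain ⟨P', hP'⟩ : ∃ P' : ℝ → (EuclideanSpace ℝ (Fin 3)) → ℝ, IsClassicalNSSolutionOn (Iio 0) 1 0 U P' := by
    refine IsClassicalNSSolutionOn.exists_pressure_Iio_of_Ioo (a := fun k : ℕ => -((k : ℝ) + 1)) hq
      fun s hs => ⟨⌈-s⌉₊, ?_⟩
    have h1 : -s ≤ (⌈-s⌉₊ : ℝ) := Nat.le_ceil (-s)
    show -((⌈-s⌉₊ : ℝ) + 1) < s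
    linarith
  refine ⟨P', hP'.congr_velocity fun t ht => ?_⟩
  funext x
  rw [if_pos (show t < 0 from ht)]

/-- ★★ **Z7. THE TAME DSS CELL MEETS THE PRINTED EXCLUSION, BY NAME.**  For every envelope constant `A > 0`
there is `c₁ = λ₁(A) > 1` (Chae–Wolf 2017 Thm 1.3 = Pineau–Vicol 2026 Thm 1.6, the tree's theorem
`NearOneDssTypeIExclusion_holds`) such that every ROOTED A–B object which is globally enveloped with constant `A`
(`HasTypeIDecay A`) and exactly past-DSS with a factor `c > 1` has `c ≥ c₁`: the tame DSS cell of Z6 (tame ⟺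
enveloped, Z5) lives at factors `λ₀ ≥ max(Λ(M), λ₁(A))`; the fine-ratio end of the tame DSS cell is dead in print. -/
theorem chaeWolf_threshold_le_pastDss_factor {A : ℝ} (hA : 0 < A) :
    ∃ c₁ : ℝ, 1 < c₁ ∧ ∀ {M : ℝ} {n : TNode}, ABTower M n.U n.P n.H → ¬ RegPt n.U 0 → HasTypeIDecay A n.U →
      ∀ {c : ℝ}, 1 < c → (∀ t < 0, ∀ x, nsRescale c n.U t x = n.U t x) → c₁ ≤ c := by
  obtain ⟨c₁, hc₁, H⟩ :=
    Literature.Barriers.NavierStokesRegularity.NearOneDssTypeIExclusion_holds.threshold_le_ratio hA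
  refine ⟨c₁, hc₁, fun {M} {n} hT h0 hdec {c} hc h => ?_⟩
  obtain ⟨P', hP'⟩ := exists_isClassicalNSSolutionOn_pastCut hT.1
  have hdec' : HasTypeIDecay A (fun t x => if t < 0 then n.U t x else 0) := by
    intro t ht x
    simp only [if_pos ht]
    exact hdec t ht x
  refine H c _ P' hc hP' (isDiscretelySelfSimilar_pastCut (lt_trans zero_lt_one hc) h) hdec' ?_
  -- nontriviality: a field vanishing on the whole open past is regular at the root
  by_contra hzero
  push Not at hzero
  apply h0
  refine ⟨1, one_pos, 0, (ae_restrict_iff' (isOpen_parabolicCylinder _ _).measurableSet).2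
    (ae_of_all _ fun z hz => ?_)⟩
  rw [mem_parabolicCylinder] at hz
  have hz1 : z.1 < 0 := by simpa using hz.1.2
  have h1 := hzero z.1 hz1 z.2
  simp only [if_pos hz1] at h1
  simp [h1]

/-- ★ **The tame DSS cell, quantified**: a TAME rooted A–B object exactly past-DSS with factor `c > 1` is globally
enveloped with some constant `A > 0` (Z5) at which the printed threshold bites: `λ₁(A) ≤ c`. -/
theorem TameRoot.exists_envelope_threshold {n : TNode} (hT : ABTower M n.U n.P n.H) (h0 : ¬ RegPt n.U 0)
    (ht : TameRoot n) {c : ℝ} (hc : 1 < c) (h : ∀ t < 0, ∀ x, nsRescale c n.U t x = n.U t x) :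
    ∃ A : ℝ, 0 < A ∧ HasTypeIDecay A n.U ∧
      ∃ c₁ : ℝ, 1 < c₁ ∧ c₁ ≤ c ∧
        ∀ {M' : ℝ} {n' : TNode}, ABTower M' n'.U n'.P n'.H → ¬ RegPt n'.U 0 → HasTypeIDecay A n'.U →
          ∀ {c' : ℝ}, 1 < c' → (∀ t < 0, ∀ x, nsRescale c' n'.U t x = n'.U t x) → c₁ ≤ c' := by
  obtain ⟨A₀, hA₀⟩ := (tameRoot_iff_hasTypeIDecay_of_pastDss hT hc h).1 ht
  -- enlarge the constant to make it positive
  have hA : HasTypeIDecay (max A₀ 1) n.U := fun t ht' x =>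
    (hA₀ t ht' x).trans (div_le_div_of_nonneg_right (le_max_left _ _)
      (add_pos_of_nonneg_of_pos (norm_nonneg _) (Real.sqrt_pos.2 (neg_pos.2 ht'))).le)
  have hpos : 0 < max A₀ 1 := lt_of_lt_of_le zero_lt_one (le_max_right _ _)
  obtain ⟨c₁, hc₁, H⟩ := chaeWolf_threshold_le_pastDss_factor hpos
  exact ⟨max A₀ 1, hpos, hA, c₁, hc₁, H hT h0 hA hc h, fun hT' h0' hdec' => H hT' h0' hdec'⟩

/-! ### Z6. THE DOUBLY-MINIMAL FORM: the two hull cells of ¬23843 -/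

/-- ★★★ **Z6. ¬23843 ⇒ A DOUBLY-MINIMAL OBJECT WHICH IS EXACTLY PAST-DSS WITH LEAST FACTOR `λ₀ ≥ Λ > 1`, OR
PAST-DSS-FREE IN THE HULL OF A UNIFORMLY RECURRENT DSS-FREE MODEL.**  If 23843 fails then at the violator's
level `I₀ < ⊤` (critical rate `M_c(I₀) ∈ [ε_L, M]`, `minLevel I₀ ≤ I₀`) there is a DOUBLY-MINIMAL rooted object
`(U, P, H)` (class `M_c(I₀)`, `𝐈 = minLevel I₀`, doubly-minimal at each of its scars — X1) such that EITHER

* **(DSS cell)** `U` is EXACTLY `λ₀`-DSS on the open past, its past-DSS factors are precisely `λ₀^ℤ`, and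
  `λ₀ ≥ Λ`, the H4-constant of the class `(M_c(I₀), minLevel I₀)` (`stub_prScalingStabilizer`, crux 1589);
  moreover it is TAME at the root iff it is a LEAF iff it is GLOBALLY ENVELOPED (`HasTypeIDecay A U`, the
  hypothesis of the printed DSS exclusions), and WILD iff it carries a satellite `y ≠ 0` — and then the whole
  NECKLACE `λ₀^k y`, `k ∈ ℤ`, of satellites accumulating at the root (Z4, Z5⁺);

* **(recurrent cell)** `U` has NO past-DSS factor `c ≠ 1`, and it is the `L³(Q_R(0))`-limit (every `R`) of
  rescalings `w_{λ'_k}` of a Type-I singularity model `w` of crux 1589 of the same class which is UNIFORMLY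
  RECURRENT under scaling and whose whole `L³_loc`-hull is DSS-free (T6 `stub_prBlowupDichotomy`). -/
theorem dss_or_recurrent_doublyMin_of_not_scarEnvelopeTypeI
    (h : ¬ Summit.NavierStokesRegularity.NavierStokesRegularity.Theses.TypeIQuarterGate.ScarEnvelopeTypeI) :
    ∃ (M : ℝ) (I₀ : ℝ≥0∞) (Λ : ℝ), I₀ < ⊤ ∧ levelCrit I₀ ∈ Icc epsL M ∧ minLevel I₀ ≤ I₀ ∧ 1 < Λ ∧
      ∃ (U : ℝ → (EuclideanSpace ℝ (Fin 3)) → (EuclideanSpace ℝ (Fin 3))) (P : ℝ → (EuclideanSpace ℝ (Fin 3)) → ℝ)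
        (H : ℝ → (EuclideanSpace ℝ (Fin 3)) → (EuclideanSpace ℝ (Fin 3)) →L[ℝ] (EuclideanSpace ℝ (Fin 3))),
        (∀ y : (EuclideanSpace ℝ (Fin 3)), DoublyMin I₀ ⟨U, P, H, y⟩) ∧ ¬ RegPt U 0 ∧
        ((∃ lam0 : ℝ, Λ ≤ lam0 ∧ (∀ t < 0, ∀ x, nsRescale lam0 U t x = U t x) ∧
            (∀ c : ℝ, 0 < c → ((∀ t < 0, ∀ x, nsRescale c U t x = U t x) ↔ ∃ k : ℤ, c = lam0 ^ k)) ∧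
            (TameRoot ⟨U, P, H, 0⟩ ↔ LeafNode ⟨U, P, H, 0⟩) ∧
            (TameRoot ⟨U, P, H, 0⟩ ↔ ∃ A : ℝ, HasTypeIDecay A U) ∧
            (¬ TameRoot ⟨U, P, H, 0⟩ ↔ ∃ y : (EuclideanSpace ℝ (Fin 3)), y ≠ 0 ∧ ¬ RegPt U y) ∧
            (∀ y : (EuclideanSpace ℝ (Fin 3)), ¬ RegPt U y → ∀ k : ℤ, ¬ RegPt U ((lam0 ^ k) • y))) ∨
         ((∀ c : ℝ, 0 < c → (∀ t < 0, ∀ x, nsRescale c U t x = U t x) → c = 1) ∧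
          ∃ (w : ℝ → (EuclideanSpace ℝ (Fin 3)) → (EuclideanSpace ℝ (Fin 3))) (q : ℝ → (EuclideanSpace ℝ (Fin 3)) → ℝ)
            (G : ℝ → (EuclideanSpace ℝ (Fin 3)) → (EuclideanSpace ℝ (Fin 3)) →L[ℝ] (EuclideanSpace ℝ (Fin 3)))
            (lam' : ℕ → ℝ),
            IsSuitableWeakSolutionOn (slab (EuclideanSpace ℝ (Fin 3)) (Iio 0) isOpen_Iio) 1 0 w q ∧
            HasWeakSpatialGradientOn (slab (EuclideanSpace ℝ (Fin 3)) (Iio 0) isOpen_Iio) w G ∧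
            typeIBound (Iio (0 : ℝ) ×ˢ univ) w q G < ⊤ ∧ HasTypeITimeDecay (levelCrit I₀) w ∧
            IsBackwardSingularPoint w 0 ∧ IsScalingUniformlyRecurrent w ∧
            (∀ (v : ℝ → (EuclideanSpace ℝ (Fin 3)) → (EuclideanSpace ℝ (Fin 3))) (l : ℕ → ℝ),
              (∀ R : ℝ, 0 < R → MemLp (Function.uncurry v) 3
                (volume.restrict (parabolicCylinder R (0 : ℝ × (EuclideanSpace ℝ (Fin 3)))))) →
              (∀ k, 0 < l k) →
              (∀ R : ℝ, 0 < R → Tendsto (fun k => eLpNorm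
                (Function.uncurry (nsRescale (l k) w) - Function.uncurry v) 3
                (volume.restrict (parabolicCylinder R (0 : ℝ × (EuclideanSpace ℝ (Fin 3)))))) atTop (𝓝 0)) →
              ∀ σ : ℝ, (∀ᵐ z ∂(volume.restrict (Iio (0 : ℝ) ×ˢ (univ : Set (EuclideanSpace ℝ (Fin 3))))),
                nsRescale (Real.exp σ) v z.1 z.2 = v z.1 z.2) → σ = 0) ∧
            (∀ k, 0 < lam' k) ∧
            (∀ R : ℝ, 0 < R → Tendsto (fun k => eLpNorm
              (Function.uncurry (nsRescale (lam' k) w) - Function.uncurry U) 3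
              (volume.restrict (parabolicCylinder R (0 : ℝ × (EuclideanSpace ℝ (Fin 3)))))) atTop (𝓝 0)))) := by
  obtain ⟨M, I₀, hI₀, hne, hcrit, -, -⟩ := exactCritical_of_not_scarEnvelopeTypeI h
  obtain ⟨n₀, hn₀⟩ := doublyMin_nonempty hI₀ hne
  have hmin : minLevel I₀ ≤ I₀ := by rw [← hn₀.2]; exact hn₀.1.2
  have hlt : minLevel I₀ < ⊤ := lt_of_le_of_lt hmin hI₀
  obtain ⟨Λ, hΛ, hfac⟩ := pastDss_factors (levelCrit I₀) (minLevel I₀) hlt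
  refine ⟨M, I₀, Λ, hI₀, hcrit, hmin, hΛ, ?_⟩
  have hroot : RootObj (levelCrit I₀) n₀ := hn₀.1.1
  rcases hroot.hullDichotomy with
    ⟨U', P', H', lam, μ, hT', h0', -, hω, -, -, -, hμ, hdss⟩ |
    ⟨U', P', H', w, q, G, lam, φ, hT', h0', -, hω, hlam, -, -, -, hsww, hwgw, hIw, hdecw, hsingw, hrec, hfree, -,
      hhull, hnod⟩
  · -- the DSS cell
    obtain ⟨U, P, H, hT, hIle, hae, hreg, hdm⟩ := hn₀.galleryLimit_rep hω.isGalleryLimit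
    have h0 : ¬ RegPt U 0 := fun hr => h0' ((hreg 0).1 hr)
    have hμ0 : 0 < μ := lt_trans zero_lt_one hμ
    have hdssU : ∀ t < 0, ∀ x, nsRescale μ U t x = U t x :=
      hT.pastDss_of_ae hμ0 (ae_slab_of_forall_cylinder hae) (ae_dss_of_pastDss hdss)
    rcases hfac U P H hT h0 hIle with htriv | ⟨lam0, hΛle, hdss0, hiff⟩
    · exact absurd (htriv μ hμ0 hdssU) hμ.ne'
    · refine ⟨U, P, H, hdm h0', h0, Or.inl ⟨lam0, hΛle, hdss0, hiff, ?_⟩⟩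
      exact pastDss_cell (n := ⟨U, P, H, 0⟩) hT (lt_of_lt_of_le hΛ hΛle) hdss0
  · -- the recurrent cell
    obtain ⟨U, P, H, hT, -, hae, hreg, hdm⟩ := hn₀.galleryLimit_rep hω.isGalleryLimit
    have h0 : ¬ RegPt U 0 := fun hr => h0' ((hreg 0).1 hr)
    have hslab : ∀ᵐ z ∂(volume.restrict (Iio (0 : ℝ) ×ˢ (univ : Set (EuclideanSpace ℝ (Fin 3))))),
        U' z.1 z.2 = U z.1 z.2 :=
      ae_slab_of_forall_cylinder fun R hR => (hae R hR).mono fun z hz => hz.symm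
    refine ⟨U, P, H, hdm h0', h0, Or.inr ⟨fun c hc hc' => ?_, w, q, G, lam ∘ φ, hsww, hwgw, hIw, hdecw, hsingw,
      hrec, hfree, fun k => hlam _, fun R hR => ?_⟩⟩
    · exact hnod c hc (hT'.pastDss_of_ae hc hslab (ae_dss_of_pastDss hc'))
    · have e : ∀ k, eLpNorm (Function.uncurry (nsRescale (lam (φ k)) w) - Function.uncurry U) 3
            (volume.restrict (parabolicCylinder R (0 : ℝ × (EuclideanSpace ℝ (Fin 3))))) =
          eLpNorm (Function.uncurry (nsRescale (lam (φ k)) w) - Function.uncurry U') 3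
            (volume.restrict (parabolicCylinder R (0 : ℝ × (EuclideanSpace ℝ (Fin 3))))) := by
        intro k
        refine eLpNorm_congr_ae ?_
        filter_upwards [hae R hR] with z hz
        simp only [Pi.sub_apply]
        change _ - U z.1 z.2 = _ - U' z.1 z.2
        rw [hz]
      simp only [Function.comp, e]
      exact hhull R hR

/-! ### Z8. THE THREE CELL-KILLERS: 23843 ⇐ (τ) ∧ (κ) ∧ (θ) -/

/-- ★★ **Z8. 23843 from the three hull-cell exclusions.**  By Z6, item 23843 follows from the exclusion of the
three cells of the hull census of DOUBLY-MINIMAL rooted objects: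
(τ) no TAME exactly-past-DSS doubly-minimal object (tame = leaf = globally enveloped, Z5⁺; in print for factors
    `λ₀ < λ₁(A)` — Chae–Wolf 2017 Thm 1.3 / Pineau–Vicol 2026 Thm 1.6, see Z7 — OPEN at coarse ratio);
(κ) no WILD exactly-past-DSS doubly-minimal object, i.e. no DSS NECKLACE `λ₀^ℤ • y` of satellites (OPEN);
(θ) no past-DSS-free doubly-minimal object in the `L³_loc`-hull of a uniformly recurrent DSS-free Type-I model
    (OPEN — the WANTED LEMMA W44-θ; barrier: recurrence alone does not force periodicity).
Each hypothesis is stated with ALL the data Z6 delivers (weakest form). -/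
theorem scarEnvelopeTypeI_of_cellExclusions
    (hτ : ∀ (I₀ : ℝ≥0∞) (U : ℝ → (EuclideanSpace ℝ (Fin 3)) → (EuclideanSpace ℝ (Fin 3)))
      (P : ℝ → (EuclideanSpace ℝ (Fin 3)) → ℝ)
      (H : ℝ → (EuclideanSpace ℝ (Fin 3)) → (EuclideanSpace ℝ (Fin 3)) →L[ℝ] (EuclideanSpace ℝ (Fin 3)))
      (lam0 A : ℝ), (∀ y : (EuclideanSpace ℝ (Fin 3)), DoublyMin I₀ ⟨U, P, H, y⟩) → ¬ RegPt U 0 → 1 < lam0 →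
      (∀ t < 0, ∀ x, nsRescale lam0 U t x = U t x) →
      (∀ c : ℝ, 0 < c → ((∀ t < 0, ∀ x, nsRescale c U t x = U t x) ↔ ∃ k : ℤ, c = lam0 ^ k)) →
      LeafNode ⟨U, P, H, 0⟩ → HasTypeIDecay A U → False)
    (hκ : ∀ (I₀ : ℝ≥0∞) (U : ℝ → (EuclideanSpace ℝ (Fin 3)) → (EuclideanSpace ℝ (Fin 3)))
      (P : ℝ → (EuclideanSpace ℝ (Fin 3)) → ℝ)
      (H : ℝ → (EuclideanSpace ℝ (Fin 3)) → (EuclideanSpace ℝ (Fin 3)) →L[ℝ] (EuclideanSpace ℝ (Fin 3)))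
      (lam0 : ℝ) (y : (EuclideanSpace ℝ (Fin 3))),
      (∀ y : (EuclideanSpace ℝ (Fin 3)), DoublyMin I₀ ⟨U, P, H, y⟩) → 1 < lam0 →
      (∀ t < 0, ∀ x, nsRescale lam0 U t x = U t x) →
      (∀ c : ℝ, 0 < c → ((∀ t < 0, ∀ x, nsRescale c U t x = U t x) ↔ ∃ k : ℤ, c = lam0 ^ k)) →
      y ≠ 0 → ¬ RegPt U y → (∀ k : ℤ, ¬ RegPt U ((lam0 ^ k) • y)) → False)
    (hθ : ∀ (I₀ : ℝ≥0∞) (U : ℝ → (EuclideanSpace ℝ (Fin 3)) → (EuclideanSpace ℝ (Fin 3)))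
      (P : ℝ → (EuclideanSpace ℝ (Fin 3)) → ℝ)
      (H : ℝ → (EuclideanSpace ℝ (Fin 3)) → (EuclideanSpace ℝ (Fin 3)) →L[ℝ] (EuclideanSpace ℝ (Fin 3)))
      (w : ℝ → (EuclideanSpace ℝ (Fin 3)) → (EuclideanSpace ℝ (Fin 3))) (q : ℝ → (EuclideanSpace ℝ (Fin 3)) → ℝ)
      (G : ℝ → (EuclideanSpace ℝ (Fin 3)) → (EuclideanSpace ℝ (Fin 3)) →L[ℝ] (EuclideanSpace ℝ (Fin 3)))
      (lam' : ℕ → ℝ),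
      (∀ y : (EuclideanSpace ℝ (Fin 3)), DoublyMin I₀ ⟨U, P, H, y⟩) → ¬ RegPt U 0 →
      (∀ c : ℝ, 0 < c → (∀ t < 0, ∀ x, nsRescale c U t x = U t x) → c = 1) →
      IsSuitableWeakSolutionOn (slab (EuclideanSpace ℝ (Fin 3)) (Iio 0) isOpen_Iio) 1 0 w q →
      HasWeakSpatialGradientOn (slab (EuclideanSpace ℝ (Fin 3)) (Iio 0) isOpen_Iio) w G →
      typeIBound (Iio (0 : ℝ) ×ˢ univ) w q G < ⊤ → HasTypeITimeDecay (levelCrit I₀) w →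
      IsBackwardSingularPoint w 0 → IsScalingUniformlyRecurrent w →
      (∀ (v : ℝ → (EuclideanSpace ℝ (Fin 3)) → (EuclideanSpace ℝ (Fin 3))) (l : ℕ → ℝ),
        (∀ R : ℝ, 0 < R → MemLp (Function.uncurry v) 3
          (volume.restrict (parabolicCylinder R (0 : ℝ × (EuclideanSpace ℝ (Fin 3)))))) →
        (∀ k, 0 < l k) →
        (∀ R : ℝ, 0 < R → Tendsto (fun k => eLpNorm
          (Function.uncurry (nsRescale (l k) w) - Function.uncurry v) 3
          (volume.restrict (parabolicCylinder R (0 : ℝ × (EuclideanSpace ℝ (Fin 3)))))) atTop (𝓝 0)) →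
        ∀ σ : ℝ, (∀ᵐ z ∂(volume.restrict (Iio (0 : ℝ) ×ˢ (univ : Set (EuclideanSpace ℝ (Fin 3))))),
          nsRescale (Real.exp σ) v z.1 z.2 = v z.1 z.2) → σ = 0) →
      (∀ k, 0 < lam' k) →
      (∀ R : ℝ, 0 < R → Tendsto (fun k => eLpNorm
        (Function.uncurry (nsRescale (lam' k) w) - Function.uncurry U) 3
        (volume.restrict (parabolicCylinder R (0 : ℝ × (EuclideanSpace ℝ (Fin 3)))))) atTop (𝓝 0)) → False) :
    Summit.NavierStokesRegularity.NavierStokesRegularity.Theses.TypeIQuarterGate.ScarEnvelopeTypeI := by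
  by_contra h
  obtain ⟨M, I₀, Λ, hI₀, hcrit, hmin, hΛ, U, P, H, hdm, h0, hcell⟩ :=
    dss_or_recurrent_doublyMin_of_not_scarEnvelopeTypeI h
  rcases hcell with ⟨lam0, hle, hdss, hfac, htl, htd, hwild, hneck⟩ |
      ⟨hfree, w, q, G, lam', hw, hG, hB, hdec, hsing, hrec, hhull, hpos, hlim⟩
  · have hlam : 1 < lam0 := lt_of_lt_of_le hΛ hle
    by_cases ht : TameRoot ⟨U, P, H, 0⟩
    · obtain ⟨A, hA⟩ := htd.1 ht
      exact hτ I₀ U P H lam0 A hdm h0 hlam hdss hfac (htl.1 ht) hA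
    · obtain ⟨y, hy, hreg⟩ := hwild.1 ht
      exact hκ I₀ U P H lam0 y hdm hlam hdss hfac hy hreg (hneck y hreg)
  · exact hθ I₀ U P H w q G lam' hdm h0 hfree hw hG hB hdec hsing hrec hhull hpos hlim

end HullJunction

end Summit.NavierStokesRegularity.NavierStokesRegularity.Cruxes.ScarEnvelopeTypeI.ZoomDictionary
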